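import Literature.MathematicalPhysics.QuantumFieldTheory.ConformalBootstrap3D.PointKernelK34v2Data

/-!
# K34v2 certificate, kernel block file H3: head segments `34 ≤ i < 39` (block-checked ones)

`decide` by kernel reduction (no `native_decide`, no extra axioms) of the block checker
`PCert.hBlockOK` of `PointKernel` on the literal data of `PointKernelK34v2Data` (cells checked corner
or chord by the rule bit); soundness is `PCert.hBlockOK_sound`.  Estimated kernel time 203 s
(4 theorems).
-/

set_option maxRecDepth 100000
set_option maxHeartbeats 0

namespace Literature.MathematicalPhysics.QuantumFieldTheory.ConformalBootstrap3D.PointKernelK34v2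

open Literature.MathematicalPhysics.QuantumFieldTheory.ConformalBootstrap3D.PointKernel

/-- head segments `[34, 36)` pass the kernel evaluator (≈66 s of kernel work). [folklore] -/
theorem hBlock_34 : certK34v2.hBlockOK hsegsK34v2 34 36 JHK34v2 = true := by
  decide +kernel

/-- head segment `[36, 37)` passes the kernel evaluator (≈43 s of kernel work). [folklore] -/
theorem hBlock_36 : certK34v2.hBlockOK hsegsK34v2 36 37 JHK34v2 = true := by
  decide +kernel

/-- head segment `[37, 38)` passes the kernel evaluator (≈43 s of kernel work). [folklore] -/
theorem hBlock_37 : certK34v2.hBlockOK hsegsK34v2 37 38 JHK34v2 = true := by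
  decide +kernel

/-- head segment `[38, 39)` passes the kernel evaluator (≈43 s of kernel work). [folklore] -/
theorem hBlock_38 : certK34v2.hBlockOK hsegsK34v2 38 39 JHK34v2 = true := by
  decide +kernel

end Literature.MathematicalPhysics.QuantumFieldTheory.ConformalBootstrap3D.PointKernelK34v2
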